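import Literature.MathematicalPhysics.KineticTheory.CellChainEnergyScale
import Literature.MathematicalPhysics.KineticTheory.SiteChainPathwiseEnergy
import Mathlib.Analysis.Complex.ExponentialBounds
import HarnessLib

/-!
# The driven cell chains at energy scale `K⁴`: Grönwall, the energy ceiling, and the two-sided energy bookkeeping

Topic `Literature/MathematicalPhysics/KineticTheory`, grouping namespace `…KineticTheory.HeatConduction`.
The section `EnergyFlow` of `LangevinChainEnergyScale.lean` (pinned chain, flow `chainFlow`),
RE-INSTANTIATED for the CELL CHAINS `cellChain ω₂ lam β γ c` (`ω₂ > 0`, `lam, β, γ ≥ 0`, any cell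
indicator `c`) on the MODEL-FREE pathwise layer: the statements are about ANY continuous path `z`
solving `z(t) = x + (0, η(t)) + ∫₀ᵗ Y(z)` on `[0, T]` (`Y = (cellChain …).langevinDrift N`,
`IsIntegralSolutionOn`; `SiteChainPathwiseEnergy.lean`), and are then specialised to the flow
`drivenFlow ((cellChain …).langevinDrift N) x (0, η)` of `ConfinedForcedFlow.lean` (whose law under the
Brownian pair is the Langevin kernel, `SiteChainLangevinKernel.lean`). Cuneo–Eckmann–Hairer–Rey-Bellet,
EJP **23** (2018) no. 55, §5 p. 11 and Lemma 5.10; with `y = z - (0, η)` the smooth part,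
`A = pinnedChainScaleA γ N`, `B = pinnedChainScaleB ω₂ lam β γ N`, `c₁ = pinnedChainScaleC ω₂ lam β γ N`:

* `cellChain_hamiltonian_smoothPart_le_scale` — **Grönwall at scale `K ≥ 1`**:
  `H(y(t)) + (B/A)K⁴ ≤ (H(x) + (B/A)K⁴) e^{(AM/K)t}` for `‖η‖ ≤ M` on `[0, T]`;
* `cellChain_hamiltonian_smoothPart_le_ceiling` — **the ceiling**: `H(x) ≤ 2K⁴`, `A M T ≤ K` ⟹
  `H(y(t)) ≤ c₁K⁴` on `[0, T]`; `cellChain_smoothPart_bounds_of_ceiling` — along such a path the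
  force-plus-friction is `≤ (Ac₁ + B)K³` and the momenta are `≤ (c₁ + 1/2)K²`;
* `cellChain_abs_hamiltonian_sub_add_dissipation_le` — **the two-sided bookkeeping**:
  `|H(z(t)) - H(x) + γ∫₀ᵗ ∑_i w_i ȳ_i²| ≤ tM(Ac₁ + B)K³ + NM((c₁ + 1/2)K² + M/2)` ("the main
  contribution to the energy difference comes from (minus) the dissipation integral", CEHR p. 11);
* `cellChain_drivenFlow_energyScale` — the same two facts for `z = drivenFlow … x (0, η)`, with the
  error in the form `C₂ M (T K³ + K² + M)`, `C₂ = Ac₁ + B + N(c₁ + 1/2)`.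

Everything is PROVED; no definition, no named fact.

## References

* N. Cuneo, J.-P. Eckmann, M. Hairer, L. Rey-Bellet, *Non-equilibrium steady states for networks of
  oscillators*, Electron. J. Probab. **23** (2018) no. 55 (arXiv:1712.09413), §3 eq. (3.3), §5 p. 11,
  Lemma 5.10.
-/

noncomputable section

open MeasureTheory Filter Topology Set Metric
open scoped NNReal

namespace Literature.MathematicalPhysics.KineticTheory.HeatConduction

open Literature.MathematicalPhysics.KineticTheory Literature.Analysis.ODE

section CellChainEnergyFlow

variable {ω₂ lam β γ : ℝ} (hω : 0 < ω₂) (hl : 0 ≤ lam) (hβ : 0 ≤ β) (hγ : 0 ≤ γ) (c : ℕ → Bool)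
  (N : ℕ)
include hω hl hβ hγ

/-- **Grönwall at scale `K ≥ 1` for the driven cell chain**: along a continuous solution `z` of
`z(t) = x + (0, η(t)) + ∫₀ᵗ Y(z)` with `‖η‖ ≤ M` on `[0, T]`, the energy of the smooth part
`y = z - (0, η)` obeys `H(y(t)) + (B/A)K⁴ ≤ (H(x) + (B/A)K⁴) e^{(AM/K)t}`
(`cellChain_linearEnergyBound_scale_offset` fed into `SiteChain.hamiltonian_smoothPart_add_le_mul_exp`).
[cite: CuneoEckmannHairerReyBellet2018, §5 p. 11 and Lemma 5.10] -/
theorem cellChain_hamiltonian_smoothPart_le_scale {K : ℝ} (hK : 1 ≤ K) {x : PhaseSpace N}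
    {η : ℝ → Fin N → ℝ} {z : ℝ → PhaseSpace N} (hzc : Continuous z) {T M : ℝ}
    (hM : ∀ t ∈ Icc 0 T, ‖η t‖ ≤ M)
    (hz : IsIntegralSolutionOn ((cellChain ω₂ lam β γ c).langevinDrift N)
      (fun t => x + ((0 : Fin N → ℝ), η t)) z T) :
    ∀ t ∈ Icc 0 T,
      (cellChain ω₂ lam β γ c).hamiltonian N (z t - ((0 : Fin N → ℝ), η t)) +
          pinnedChainScaleB ω₂ lam β γ N / pinnedChainScaleA γ N * K ^ 4 ≤
        ((cellChain ω₂ lam β γ c).hamiltonian N x +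
            pinnedChainScaleB ω₂ lam β γ N / pinnedChainScaleA γ N * K ^ 4) *
          Real.exp (pinnedChainScaleA γ N * M / K * t) := by
  intro t ht
  have hP := cellChain_uniformlyConfining hω hl hβ hγ c
  have hU1 : ∀ i, ContDiff ℝ 1 ((cellChain ω₂ lam β γ c).U i) := fun i =>
    (hP.contDiff_U i).of_le (by norm_num)
  have hV1 : ∀ i, ContDiff ℝ 1 ((cellChain ω₂ lam β γ c).V i) := fun i =>
    (hP.contDiff_V i).of_le (by norm_num)
  have h := (cellChain ω₂ lam β γ c).hamiltonian_smoothPart_add_le_mul_exp hU1 hV1 hP.γ_nonneg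
    (a := pinnedChainScaleA γ N / K)
    (d := pinnedChainScaleB ω₂ lam β γ N / pinnedChainScaleA γ N * K ^ 4)
    (fun y => cellChain_linearEnergyBound_scale_offset hω hl hβ hγ c N hK y) hzc hM hz t ht
  have e : pinnedChainScaleA γ N / K * M = pinnedChainScaleA γ N * M / K := by ring
  rw [e] at h
  exact h

/-- **The energy ceiling**: if `H(x) ≤ 2K⁴`, `‖η‖ ≤ M` on `[0, T]` and `A M T ≤ K` (`K ≥ 1`), then the
smooth part of any continuous solution of the driven cell chain has `H(z(t) - (0, η(t))) ≤ c₁K⁴` on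
`[0, T]` (`c₁ = pinnedChainScaleC = 3(2 + B/A)`, as `e^{(AM/K)t} ≤ e ≤ 3`). [folklore] -/
theorem cellChain_hamiltonian_smoothPart_le_ceiling {K : ℝ} (hK : 1 ≤ K) {x : PhaseSpace N}
    (hx : (cellChain ω₂ lam β γ c).hamiltonian N x ≤ 2 * K ^ 4)
    {η : ℝ → Fin N → ℝ} {z : ℝ → PhaseSpace N} (hzc : Continuous z) {T M : ℝ}
    (hM : ∀ t ∈ Icc 0 T, ‖η t‖ ≤ M) (hAMT : pinnedChainScaleA γ N * M * T ≤ K)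
    (hz : IsIntegralSolutionOn ((cellChain ω₂ lam β γ c).langevinDrift N)
      (fun t => x + ((0 : Fin N → ℝ), η t)) z T) :
    ∀ t ∈ Icc 0 T, (cellChain ω₂ lam β γ c).hamiltonian N (z t - ((0 : Fin N → ℝ), η t)) ≤
      pinnedChainScaleC ω₂ lam β γ N * K ^ 4 := by
  intro t ht
  set A := pinnedChainScaleA γ N with hA
  set B := pinnedChainScaleB ω₂ lam β γ N with hB
  have hT : 0 ≤ T := ht.1.trans ht.2
  have hM0 : 0 ≤ M := (norm_nonneg _).trans (hM 0 ⟨le_rfl, hT⟩)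
  have hK0 : 0 < K := by linarith
  have hA1 : 1 ≤ A := one_le_pinnedChainScaleA hγ N
  have hA0 : 0 < A := by linarith
  have hB0 : 0 ≤ B := pinnedChainScaleB_nonneg hω.le hl hβ hγ N
  have hD0 : 0 ≤ B / A * K ^ 4 := by positivity
  have h1 := cellChain_hamiltonian_smoothPart_le_scale hω hl hβ hγ c N hK hzc hM hz t ht
  rw [← hA, ← hB] at h1
  have hexp : Real.exp (A * M / K * t) ≤ 3 := by
    have h2 : A * M / K * t ≤ 1 := by
      rw [div_mul_eq_mul_div, div_le_one hK0]
      calc A * M * t ≤ A * M * T := mul_le_mul_of_nonneg_left ht.2 (by positivity)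
        _ ≤ K := hAMT
    calc Real.exp (A * M / K * t) ≤ Real.exp 1 := Real.exp_le_exp.2 h2
      _ ≤ 3 := Real.exp_one_lt_three.le
  have h3 : ((cellChain ω₂ lam β γ c).hamiltonian N x + B / A * K ^ 4) * Real.exp (A * M / K * t) ≤
      (2 * K ^ 4 + B / A * K ^ 4) * 3 :=
    mul_le_mul (by linarith) hexp (Real.exp_pos _).le (by positivity)
  have h4 : (2 * K ^ 4 + B / A * K ^ 4) * 3 - B / A * K ^ 4 ≤
      pinnedChainScaleC ω₂ lam β γ N * K ^ 4 := by
    unfold pinnedChainScaleC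
    rw [← hA, ← hB]
    nlinarith
  linarith

/-- **Bounds along a path under the ceiling**: under the hypotheses of the ceiling lemma, for every
`s ∈ [0, T]` the force-plus-friction of the smooth part is `≤ (Ac₁ + B)K³` and each of its momenta is
`≤ (c₁ + 1/2)K²` (the linear energy bound and the momentum bound at scale `K`, at energy `≤ c₁K⁴`).
[cite: CuneoEckmannHairerReyBellet2018, Lemma 5.10] -/
theorem cellChain_smoothPart_bounds_of_ceiling {K : ℝ} (hK : 1 ≤ K) {x : PhaseSpace N}
    (hx : (cellChain ω₂ lam β γ c).hamiltonian N x ≤ 2 * K ^ 4)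
    {η : ℝ → Fin N → ℝ} {z : ℝ → PhaseSpace N} (hzc : Continuous z) {T M : ℝ}
    (hM : ∀ t ∈ Icc 0 T, ‖η t‖ ≤ M) (hAMT : pinnedChainScaleA γ N * M * T ≤ K)
    (hz : IsIntegralSolutionOn ((cellChain ω₂ lam β γ c).langevinDrift N)
      (fun t => x + ((0 : Fin N → ℝ), η t)) z T) :
    ∀ s ∈ Icc 0 T,
      (∑ i, |partialQ i ((cellChain ω₂ lam β γ c).hamiltonian N) (z s - ((0 : Fin N → ℝ), η s))|) +
            2 * γ * ∑ i, |(z s - ((0 : Fin N → ℝ), η s)).2 i| ≤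
          (pinnedChainScaleA γ N * pinnedChainScaleC ω₂ lam β γ N + pinnedChainScaleB ω₂ lam β γ N) *
            K ^ 3 ∧
        ∀ i, |(z s - ((0 : Fin N → ℝ), η s)).2 i| ≤ (pinnedChainScaleC ω₂ lam β γ N + 1 / 2) * K ^ 2 := by
  intro s hs
  set H := (cellChain ω₂ lam β γ c).hamiltonian N with hHdef
  set A := pinnedChainScaleA γ N with hA
  set B := pinnedChainScaleB ω₂ lam β γ N with hB
  set c₁ := pinnedChainScaleC ω₂ lam β γ N with hc₁
  have hK0 : 0 < K := by linarith
  have hA1 : 1 ≤ A := one_le_pinnedChainScaleA hγ N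
  have hceil : H (z s - ((0 : Fin N → ℝ), η s)) ≤ c₁ * K ^ 4 :=
    cellChain_hamiltonian_smoothPart_le_ceiling hω hl hβ hγ c N hK hx hzc hM hAMT hz s hs
  refine ⟨?_, fun i => ?_⟩
  · have h1 := cellChain_linearEnergyBound_scale hω hl hβ hγ c N hK (z s - ((0 : Fin N → ℝ), η s))
    rw [← hHdef, ← hA, ← hB] at h1
    have h2 : A / K * H (z s - ((0 : Fin N → ℝ), η s)) ≤ A / K * (c₁ * K ^ 4) :=
      mul_le_mul_of_nonneg_left hceil (by positivity)
    have h3 : A / K * (c₁ * K ^ 4) = A * c₁ * K ^ 3 := by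
      rw [div_mul_eq_mul_div, div_eq_iff hK0.ne']
      ring
    linarith
  · have h1 := cellChain_abs_momentum_le_scale hω hl hβ hγ c N hK0 (z s - ((0 : Fin N → ℝ), η s)) i
    rw [← hHdef] at h1
    have h2 : H (z s - ((0 : Fin N → ℝ), η s)) / K ^ 2 ≤ c₁ * K ^ 4 / K ^ 2 :=
      div_le_div_of_nonneg_right hceil (by positivity)
    have h3 : c₁ * K ^ 4 / K ^ 2 = c₁ * K ^ 2 := by
      rw [div_eq_iff (pow_ne_zero 2 hK0.ne')]
      ring
    linarith

/-- **The two-sided energy bookkeeping along a driven path of the cell chain** (CEHR §5, p. 11: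
"the main contribution to the energy difference `H(z_{t*}) - H(z₀)` comes from (minus) the
dissipation integral"): if `H(x) ≤ 2K⁴`, `η` is continuous with `‖η‖ ≤ M` on `[0, T]` and
`A M T ≤ K` (`K ≥ 1`), then for every continuous solution `z` of `z(t) = x + (0, η(t)) + ∫₀ᵗ Y(z)` on
`[0, T]` and every `t ∈ [0, T]`,
`|H(z(t)) - H(x) + γ∫₀ᵗ ∑_i w_i ȳ_i²| ≤ t M (Ac₁ + B) K³ + N M ((c₁ + 1/2) K² + M/2)`: by the identity
`SiteChain.hamiltonian_eq_sub_dissipation_add_work` the left side is `|∫₀ᵗ W + ∑_i(ȳ_iη_i + η_i²/2)|`,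
the work density is `≤ M (Ac₁ + B) K³` and the shift `≤ N M ((c₁ + 1/2)K² + M/2)` under the ceiling.
[cite: CuneoEckmannHairerReyBellet2018, §5 p. 11 and Lemma 5.10] -/
theorem cellChain_abs_hamiltonian_sub_add_dissipation_le {K : ℝ} (hK : 1 ≤ K) {x : PhaseSpace N}
    (hx : (cellChain ω₂ lam β γ c).hamiltonian N x ≤ 2 * K ^ 4)
    {η : ℝ → Fin N → ℝ} (hη : Continuous η) {z : ℝ → PhaseSpace N} (hzc : Continuous z) {T M : ℝ}
    (hM : ∀ t ∈ Icc 0 T, ‖η t‖ ≤ M) (hAMT : pinnedChainScaleA γ N * M * T ≤ K)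
    (hz : IsIntegralSolutionOn ((cellChain ω₂ lam β γ c).langevinDrift N)
      (fun t => x + ((0 : Fin N → ℝ), η t)) z T) {t : ℝ} (ht : t ∈ Icc 0 T) :
    |(cellChain ω₂ lam β γ c).hamiltonian N (z t) - (cellChain ω₂ lam β γ c).hamiltonian N x +
        γ * ∫ s in (0 : ℝ)..t, ∑ i, OscillatorChain.bathWeight N i *
          (z s - ((0 : Fin N → ℝ), η s)).2 i ^ 2| ≤
      t * M * ((pinnedChainScaleA γ N * pinnedChainScaleC ω₂ lam β γ N +
          pinnedChainScaleB ω₂ lam β γ N) * K ^ 3) +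
        N * M * ((pinnedChainScaleC ω₂ lam β γ N + 1 / 2) * K ^ 2 + M / 2) := by
  set P := cellChain ω₂ lam β γ c with hPdef
  set H := P.hamiltonian N with hHdef
  set A := pinnedChainScaleA γ N with hA
  set B := pinnedChainScaleB ω₂ lam β γ N with hB
  set c₁ := pinnedChainScaleC ω₂ lam β γ N with hc₁
  have hP := cellChain_uniformlyConfining hω hl hβ hγ c
  have hU1 : ∀ i, ContDiff ℝ 1 (P.U i) := fun i => (hP.contDiff_U i).of_le (by norm_num)
  have hV1 : ∀ i, ContDiff ℝ 1 (P.V i) := fun i => (hP.contDiff_V i).of_le (by norm_num)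
  have hT : 0 ≤ T := ht.1.trans ht.2
  have hM0 : 0 ≤ M := (norm_nonneg _).trans (hM 0 ⟨le_rfl, hT⟩)
  have hPγ : P.γ = γ := rfl
  have hbounds := cellChain_smoothPart_bounds_of_ceiling hω hl hβ hγ c N hK hx hzc hM hAMT hz
  -- the identity
  have hid := P.hamiltonian_eq_sub_dissipation_add_work hU1 hV1 hη hzc hz ht
  rw [hPγ, ← hHdef] at hid
  have hre : H (z t) - H x + γ * ∫ s in (0 : ℝ)..t, ∑ i, OscillatorChain.bathWeight N i *
        (z s - ((0 : Fin N → ℝ), η s)).2 i ^ 2 =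
      (∫ s in (0 : ℝ)..t, ∑ i, (partialQ i H (z s - ((0 : Fin N → ℝ), η s)) -
          γ * OscillatorChain.bathWeight N i * (z s - ((0 : Fin N → ℝ), η s)).2 i) * η s i) +
        ∑ i, ((z t - ((0 : Fin N → ℝ), η t)).2 i * η t i + η t i ^ 2 / 2) := by
    rw [hid]
    ring
  rw [hre]
  -- the forcing work
  have hwork : |∫ s in (0 : ℝ)..t, ∑ i, (partialQ i H (z s - ((0 : Fin N → ℝ), η s)) -
        γ * OscillatorChain.bathWeight N i * (z s - ((0 : Fin N → ℝ), η s)).2 i) * η s i| ≤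
      t * M * ((A * c₁ + B) * K ^ 3) := by
    have hb : ∀ s ∈ uIoc (0 : ℝ) t, ‖∑ i, (partialQ i H (z s - ((0 : Fin N → ℝ), η s)) -
        γ * OscillatorChain.bathWeight N i * (z s - ((0 : Fin N → ℝ), η s)).2 i) * η s i‖ ≤
        M * ((A * c₁ + B) * K ^ 3) := by
      intro s hs
      have hs' : s ∈ Icc 0 T := by
        rw [uIoc_of_le ht.1] at hs
        exact ⟨hs.1.le, hs.2.trans ht.2⟩
      rw [Real.norm_eq_abs]
      have h1 := P.abs_sum_work_le hP.γ_nonneg (z s - ((0 : Fin N → ℝ), η s)) (η s)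
      rw [hPγ] at h1
      refine h1.trans ?_
      have h0 : 0 ≤ (∑ i, |partialQ i H (z s - ((0 : Fin N → ℝ), η s))|) +
          2 * γ * ∑ i, |(z s - ((0 : Fin N → ℝ), η s)).2 i| := by
        have : 0 ≤ ∑ i, |partialQ i H (z s - ((0 : Fin N → ℝ), η s))| :=
          Finset.sum_nonneg fun i _ => abs_nonneg _
        have : 0 ≤ ∑ i, |(z s - ((0 : Fin N → ℝ), η s)).2 i| :=
          Finset.sum_nonneg fun i _ => abs_nonneg _
        positivity
      exact mul_le_mul (hM s hs') (hbounds s hs').1 h0 hM0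
    have h := intervalIntegral.norm_integral_le_of_norm_le_const hb
    rw [Real.norm_eq_abs, sub_zero, abs_of_nonneg ht.1] at h
    calc _ ≤ M * ((A * c₁ + B) * K ^ 3) * t := h
      _ = t * M * ((A * c₁ + B) * K ^ 3) := by ring
  -- the final-time momentum shift
  have hshift : |∑ i, ((z t - ((0 : Fin N → ℝ), η t)).2 i * η t i + η t i ^ 2 / 2)| ≤
      N * M * ((c₁ + 1 / 2) * K ^ 2 + M / 2) :=
    abs_sum_mul_add_sq_half_le (hbounds t ht).2 (hM t ht)
  exact (abs_add_le _ _).trans (add_le_add hwork hshift)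

/-- **The energy bookkeeping at scale `K⁴` along the driven flow of the cell chain.** For `K ≥ 1`,
`H(x) ≤ 2K⁴`, a continuous momentum-noise path `η` with `‖η‖ ≤ M` on `[0, T]` and `A M T ≤ K`, the
flow `z = drivenFlow ((cellChain …).langevinDrift N) x (0, η)` satisfies on `[0, T]`: the ceiling
`H(z(t) - (0, η(t))) ≤ c₁K⁴`, and
`|H(z(t)) - H(x) + γ∫₀ᵗ ∑_i w_i ȳ_i²| ≤ C₂ M (T K³ + K² + M)` with `C₂ = Ac₁ + B + N(c₁ + 1/2)` — a
noise of size `δK` over a time `O(1/δ… )` moves the energy by `O(δK⁴)` up to the dissipation.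
[cite: CuneoEckmannHairerReyBellet2018, §5 p. 11 and Lemma 5.10] -/
theorem cellChain_drivenFlow_energyScale {K : ℝ} (hK : 1 ≤ K) (x : PhaseSpace N)
    (hx : (cellChain ω₂ lam β γ c).hamiltonian N x ≤ 2 * K ^ 4) (η : ℝ → Fin N → ℝ) (T M : ℝ)
    (hη : Continuous η) (hM : ∀ t ∈ Icc 0 T, ‖η t‖ ≤ M) (hAMT : pinnedChainScaleA γ N * M * T ≤ K)
    (t : ℝ) (ht : t ∈ Icc 0 T) :
    (cellChain ω₂ lam β γ c).hamiltonian N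
        (drivenFlow ((cellChain ω₂ lam β γ c).langevinDrift N) x (fun s => ((0 : Fin N → ℝ), η s)) t -
          ((0 : Fin N → ℝ), η t)) ≤ pinnedChainScaleC ω₂ lam β γ N * K ^ 4 ∧
      |(cellChain ω₂ lam β γ c).hamiltonian N
            (drivenFlow ((cellChain ω₂ lam β γ c).langevinDrift N) x (fun s => ((0 : Fin N → ℝ), η s)) t) -
          (cellChain ω₂ lam β γ c).hamiltonian N x +
          γ * ∫ s in (0 : ℝ)..t, ∑ i, OscillatorChain.bathWeight N i *
            (drivenFlow ((cellChain ω₂ lam β γ c).langevinDrift N) x (fun s => ((0 : Fin N → ℝ), η s)) s -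
              ((0 : Fin N → ℝ), η s)).2 i ^ 2| ≤
        (pinnedChainScaleA γ N * pinnedChainScaleC ω₂ lam β γ N + pinnedChainScaleB ω₂ lam β γ N +
            N * (pinnedChainScaleC ω₂ lam β γ N + 1 / 2)) * M * (T * K ^ 3 + K ^ 2 + M) := by
  set A := pinnedChainScaleA γ N with hA
  set B := pinnedChainScaleB ω₂ lam β γ N with hB
  set c₁ := pinnedChainScaleC ω₂ lam β γ N with hc₁
  have hP := cellChain_uniformlyConfining hω hl hβ hγ c
  have hz := hP.isIntegralSolutionOn_drivenFlow N x hη T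
  have hzc := hP.continuous_drivenFlow N x hη
  refine ⟨cellChain_hamiltonian_smoothPart_le_ceiling hω hl hβ hγ c N hK hx hzc hM hAMT hz t ht, ?_⟩
  refine (cellChain_abs_hamiltonian_sub_add_dissipation_le hω hl hβ hγ c N hK hx hη hzc hM hAMT hz
    ht).trans ?_
  rw [← hA, ← hB, ← hc₁]
  have hT : 0 ≤ T := ht.1.trans ht.2
  have hM0 : 0 ≤ M := (norm_nonneg _).trans (hM 0 ⟨le_rfl, hT⟩)
  have hK0 : 0 < K := by linarith
  have hA1 : 1 ≤ A := one_le_pinnedChainScaleA hγ N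
  have hB0 : 0 ≤ B := pinnedChainScaleB_nonneg hω.le hl hβ hγ N
  have hc0 : 0 ≤ c₁ := pinnedChainScaleC_nonneg hω.le hl hβ hγ N
  have hX : 0 ≤ A * c₁ + B := by positivity
  have hN : (0 : ℝ) ≤ N := Nat.cast_nonneg N
  have hK2 : 0 ≤ K ^ 2 := by positivity
  have hK3 : 0 ≤ K ^ 3 := by positivity
  nlinarith [mul_nonneg (mul_nonneg (mul_nonneg hX hM0) hK3) (sub_nonneg.2 ht.2),
    mul_nonneg (mul_nonneg (mul_nonneg (mul_nonneg hN hc0) hM0) hT) hK3,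
    mul_nonneg (mul_nonneg (mul_nonneg hN hM0) hT) hK3,
    mul_nonneg (mul_nonneg hX hM0) hK2, mul_nonneg hX (mul_nonneg hM0 hM0),
    mul_nonneg (mul_nonneg hN hc0) (mul_nonneg hM0 hM0)]

end CellChainEnergyFlow

end Literature.MathematicalPhysics.KineticTheory.HeatConduction
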